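import Literature.MathematicalPhysics.KineticTheory.EnskogRateConfigContinuity
import Literature.MathematicalPhysics.KineticTheory.HardSphereOrbitVariation
import Literature.MathematicalPhysics.KineticTheory.CollisionWindowCompensator
import HarnessLib

/-!
# Pathwise window reduction of the Enskog time integral at the constant mark

Topic `Literature/MathematicalPhysics/KineticTheory` — along ONE good orbit `s ↦ Φ_s z` of a hard-sphere flow on
`𝕋³`, the Enskog term `σ³ ∫₀^τ e_s(Φ_s z) ds` of the even collision statistic at the constant mark
(`evenStat … (fun _ => 1)`, Enskog's collision frequency) is compared with its LEFT RIEMANN SUM over the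
window starts, `riemannEnskog σ N Φ τ a χ g r z = σ³ Σ_{k<Kw} w · e_{kw}(Φ_{kw} z)` (`CollisionWindowCompensator`:
`Kw = windowNum N τ a` windows of length `w = windowLen N τ a`, `Kw · w = τ`).  Deterministic bookkeeping
(Cercignani–Illner–Pulvirenti 1994 App. 4.A; Chapman–Cowling 1970 §16.4 for the Enskog frequency):

* `exists_modulus_mul_le` — real-variable lemma: for `G` bounded on `[0, ∞)`, continuous on `(0, ∞)` and
  vanishing on `[η₄, ∞)` (the shape of `a ↦ g(a)·Y(a)`, `Y` the contact value with its `deriv`-junk at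
  `0`), the product `G(a)·B` is uniformly continuous in `a` against factors `|B| ≤ D·a`, `|B| ≤ M`;
* `collisionPairSum_mono_set`, `IsHardSphereTrajectory.sum_collisionPairSum_Ioc_eq` — monotonicity of
  nonnegative collision sums in the window and their additivity over the windows `(kw, (k+1)w]`;
* `abs_setIntegral_Icc_sub_riemann_le` — the abstract left-Riemann-sum estimate on `[0, τ]` from
  per-window oscillation bounds;
* `abs_enskogIntegral_sub_riemannEnskog_le` — **the pathwise estimate**: on a good orbit with kinetic
  energy `≤ K (N+1)`, given a bound `C_χ` and a time modulus `ω` of `χ` over `w`, a bound `C_G` of `g·Y`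
  and a modulus `κ ↦ ϵ_G` of `(g·Y)(a)·B` in the sense of `exists_modulus_mul_le`,
  `|σ³∫₀^τ e_s(Φ_s z) ds − RE(z)| ≤ σ³ { τ (ω C_G M_B + C_χ ϵ_G + 8π C_χ C_G L M K w)
      + 4π C_χ C_G M² (w/(N+1)) · Σ_{collisions in (0, τ]} Σ_{ordered pairs} (1 + ‖vᵢ‖² + ‖vⱼ‖²) }`,
  `M = 3/(πr³)`, `L = 3/(πr⁴)`, `M_B = 2π M² √(2K)`: within a window the rate changes through `χ` (modulus),
  through the positions (mean and speed-weighted displacements `≤ √(2K) w`, `2K w` per particle,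
  `HardSphereOrbitVariation`; cone kernel Lipschitz, `EnskogRateConfigContinuity`) and through the velocity
  jumps at the collisions inside the window (`sum_norm_vel_sub_vel_le`), the pair functional being bilinear.

## References

* C. Cercignani, R. Illner, M. Pulvirenti, *The Mathematical Theory of Dilute Gases* (1994), App. 4.A.
  [CIPDiluteGases1994]
* S. Chapman, T. G. Cowling, *The Mathematical Theory of Non-Uniform Gases*, 3rd ed. (1970), §16.4.
  [ChapmanCowling1970]

Not here: no probability — the passage to the local Gibbs law (tightness of the kinetic energy and of
the collision functional, union bound) is problem-side.
-/

noncomputable section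

open MeasureTheory Set Filter Topology
open scoped ENNReal InnerProductSpace BigOperators

namespace Literature.MathematicalPhysics.KineticTheory

open Literature.Analysis.FluidPDE

/-! ## The modulus lemma for `(g·Y)(a) · B` -/

/-- **Uniform continuity of `G(a)·B` across the discontinuity of `G` at `0`.**  Let `G : ℝ → ℝ` be bounded by
`C_G` on `[0, ∞)`, continuous on `(0, ∞)` and `0` on `[η₄, ∞)` (`η₄ > 0`) — the shape of `a ↦ g(a)Y(a)` for
a continuous cutoff `g` vanishing above `η₄` and the contact value `Y`, analytic on the open low-density
band but with a junk value at `a = 0`.  Then for `D, M ≥ 0` and `ϵ > 0` there is `κ > 0` such that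
`|G(a) − G(a')| · |B| ≤ ϵ` whenever `a, a' ≥ 0`, `|a − a'| ≤ κ`, `|B| ≤ D·a` and `|B| ≤ M`: for `a ≤ θ`
the factor `|B| ≤ Dθ` is small; for `a > θ` both arguments lie in `[θ/2, ∞)`, where `G` is uniformly
continuous (compactness of `[θ/2, η₄ + 1]`, `G = 0` beyond). [folklore] -/
theorem exists_modulus_mul_le {G : ℝ → ℝ} {η₄ CG : ℝ} (hGc : ContinuousOn G (Set.Ioi 0))
    (hG0 : ∀ a, η₄ ≤ a → G a = 0) (hGb : ∀ a, 0 ≤ a → |G a| ≤ CG) {D M ϵ : ℝ} (hD : 0 ≤ D)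
    (hM : 0 ≤ M) (hϵ : 0 < ϵ) :
    ∃ κ : ℝ, 0 < κ ∧ ∀ a a' B : ℝ, 0 ≤ a → 0 ≤ a' → |B| ≤ D * a → |B| ≤ M → |a - a'| ≤ κ →
      |G a - G a'| * |B| ≤ ϵ := by
  have hCG0 : 0 ≤ CG := (abs_nonneg _).trans (hGb 0 le_rfl)
  set θ := ϵ / (2 * CG * D + 1) with hθ
  have hθpos : 0 < θ := by positivity
  -- uniform continuity of `G` on the compact `[θ/2, η₄ + 1] ⊆ (0, ∞)`
  have hK : IsCompact (Icc (θ / 2) (η₄ + 1)) := isCompact_Icc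
  have hsub : Icc (θ / 2) (η₄ + 1) ⊆ Ioi 0 := fun x hx => lt_of_lt_of_le (by positivity) hx.1
  have hUC := Metric.uniformContinuousOn_iff.1 (hK.uniformContinuousOn_of_continuous (hGc.mono hsub))
  obtain ⟨δ, hδ, hδU⟩ := hUC (ϵ / (M + 1)) (by positivity)
  refine ⟨min (θ / 2) (min (δ / 2) (1 / 2)), by positivity, fun a a' B ha ha' hBD hBM haa' => ?_⟩
  have hκθ : min (θ / 2) (min (δ / 2) (1 / 2)) ≤ θ / 2 := min_le_left _ _
  have hκδ : min (θ / 2) (min (δ / 2) (1 / 2)) ≤ δ / 2 := (min_le_right _ _).trans (min_le_left _ _)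
  have hκ1 : min (θ / 2) (min (δ / 2) (1 / 2)) ≤ 1 / 2 := (min_le_right _ _).trans (min_le_right _ _)
  have haa : |a - a'| ≤ θ / 2 := haa'.trans hκθ
  by_cases hsmall : a ≤ θ
  · -- small density: the factor `B` is small
    calc |G a - G a'| * |B| ≤ (|G a| + |G a'|) * (D * a) :=
          mul_le_mul (abs_sub _ _) hBD (abs_nonneg _) (by positivity)
      _ ≤ (CG + CG) * (D * θ) := mul_le_mul (add_le_add (hGb a ha) (hGb a' ha'))
          (mul_le_mul_of_nonneg_left hsmall hD) (by positivity) (by positivity)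
      _ = ϵ * (2 * CG * D / (2 * CG * D + 1)) := by rw [hθ]; ring
      _ ≤ ϵ * 1 := by
          refine mul_le_mul_of_nonneg_left ?_ hϵ.le
          rw [div_le_one (by positivity)]
          linarith
      _ = ϵ := mul_one ϵ
  · push Not at hsmall
    have ha2 : θ / 2 ≤ a := by linarith
    have ha'2 : θ / 2 ≤ a' := by
      have := (abs_sub_le_iff.1 haa).1
      linarith
    by_cases hbig : η₄ + 1 < a ∨ η₄ + 1 < a'
    · -- both arguments beyond `η₄`: `G` vanishes at both
      have h1 : |a - a'| ≤ 1 / 2 := haa'.trans hκ1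
      have hb1 := (abs_sub_le_iff.1 h1).1
      have hb2 := (abs_sub_le_iff.1 h1).2
      have hGa : G a = 0 := hG0 a (by rcases hbig with h | h <;> linarith)
      have hGa' : G a' = 0 := hG0 a' (by rcases hbig with h | h <;> linarith)
      rw [hGa, hGa', sub_self, abs_zero, zero_mul]
      exact hϵ.le
    · push Not at hbig
      have hmem : a ∈ Icc (θ / 2) (η₄ + 1) := ⟨ha2, hbig.1⟩
      have hmem' : a' ∈ Icc (θ / 2) (η₄ + 1) := ⟨ha'2, hbig.2⟩
      have hdist : dist a a' < δ := by
        rw [Real.dist_eq]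
        linarith [haa'.trans hκδ]
      have hG := (hδU a hmem a' hmem' hdist).le
      rw [Real.dist_eq] at hG
      calc |G a - G a'| * |B| ≤ ϵ / (M + 1) * M := mul_le_mul hG hBM (abs_nonneg _) (by positivity)
        _ ≤ ϵ / (M + 1) * (M + 1) := by gcongr; linarith
        _ = ϵ := div_mul_cancel₀ ϵ (by positivity)

/-! ## Collision sums over windows -/

section CollisionSums

variable {d : Type*} [Fintype d] {X : Type*} {N : ℕ} {G : Geometry d X} {ε : ℝ}

/-- A nonnegative collision pair sum is monotone in the window (finitely many collision times in the
larger window). [folklore] -/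
theorem collisionPairSum_mono_set {γ : ℝ → Config N d X} {S T : Set ℝ}
    (hT : (collisionTimes G ε γ ∩ T).Finite) (hST : S ⊆ T) {g : ℝ → Fin N → Fin N → ℝ}
    (hg : ∀ t i j, 0 ≤ g t i j) :
    collisionPairSum G ε γ S g ≤ collisionPairSum G ε γ T g := by
  have hS : (collisionTimes G ε γ ∩ S).Finite := hT.subset (inter_subset_inter_right _ hST)
  have hD : (collisionTimes G ε γ ∩ (T \ S)).Finite := hT.subset (inter_subset_inter_right _ sdiff_subset)
  have h := collisionPairSum_union hS hD disjoint_sdiff_right g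
  rw [union_sdiff_cancel hST] at h
  rw [h]
  exact le_add_of_nonneg_right (collisionPairSum_nonneg hg)

/-- **Additivity of collision pair sums over consecutive windows**: along a hard-sphere trajectory,
`Σ_{k<m} CPS((kw, (k+1)w]) = CPS((0, m w])` (`0 ≤ w`). [folklore] -/
theorem _root_.Literature.Analysis.FluidPDE.IsHardSphereTrajectory.sum_collisionPairSum_Ioc_eq
    [TopologicalSpace X] {γ : ℝ → Config N d X} (h : IsHardSphereTrajectory G ε N γ)
    {M : Type*} [AddCommMonoid M] (g : ℝ → Fin N → Fin N → M) {w : ℝ} (hw : 0 ≤ w) (m : ℕ) :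
    ∑ k ∈ Finset.range m, collisionPairSum G ε γ (Ioc ((k : ℝ) * w) (((k : ℝ) + 1) * w)) g =
      collisionPairSum G ε γ (Ioc 0 ((m : ℝ) * w)) g := by
  induction m with
  | zero => simp [collisionPairSum_empty]
  | succ m ih =>
    rw [Finset.sum_range_succ, ih, Nat.cast_succ,
      ← collisionPairSum_union (h.finite_collisionTimes_inter_Ioc _ _)
        (h.finite_collisionTimes_inter_Ioc _ _) (Ioc_disjoint_Ioc_of_le le_rfl) g,
      Ioc_union_Ioc_eq_Ioc (by positivity) (by nlinarith)]

end CollisionSums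

/-! ## The abstract left-Riemann-sum estimate -/

/-- **Left Riemann sums from per-window oscillation bounds.**  If `f` is integrable on `[0, τ]`, `τ = K w`
with `w > 0`, and `|f s − f(kw)| ≤ M_k` for `s ∈ (kw, (k+1)w]`, `k < K`, then
`|∫_{[0,τ]} f − Σ_{k<K} w f(kw)| ≤ w Σ_{k<K} M_k` (the endpoint `{0}` is Lebesgue-null). [folklore] -/
theorem abs_setIntegral_Icc_sub_riemann_le {f : ℝ → ℝ} {τ w : ℝ} {K : ℕ} (hw : 0 < w)
    (hKw : (K : ℝ) * w = τ) (hf : IntegrableOn f (Icc 0 τ)) {M : ℕ → ℝ}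
    (hM : ∀ k < K, ∀ s ∈ Ioc ((k : ℝ) * w) (((k : ℝ) + 1) * w), |f s - f ((k : ℝ) * w)| ≤ M k) :
    |(∫ s in Icc (0 : ℝ) τ, f s) - ∑ k ∈ Finset.range K, w * f ((k : ℝ) * w)| ≤
      w * ∑ k ∈ Finset.range K, M k := by
  have hτ : 0 ≤ τ := by rw [← hKw]; positivity
  have hmono : ∀ k : ℕ, (k : ℝ) * w ≤ ((k : ℝ) + 1) * w := fun k => by nlinarith
  have hsub : ∀ k < K, Icc ((k : ℝ) * w) (((k : ℝ) + 1) * w) ⊆ Icc 0 τ := by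
    intro k hk
    have hk' : (k : ℝ) + 1 ≤ K := by exact_mod_cast hk
    refine Icc_subset_Icc (by positivity) ?_
    rw [← hKw]
    exact mul_le_mul_of_nonneg_right hk' hw.le
  have hint : ∀ k < K, IntervalIntegrable f volume ((k : ℝ) * w) (((k : ℝ) + 1) * w) := by
    intro k hk
    refine (hf.mono_set ?_).intervalIntegrable
    rw [uIcc_of_le (hmono k)]
    exact hsub k hk
  have hint' : ∀ k < K, IntervalIntegrable f volume ((fun k : ℕ => (k : ℝ) * w) k)
      ((fun k : ℕ => (k : ℝ) * w) (k + 1)) := by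
    intro k hk
    have := hint k hk
    simpa only [Nat.cast_succ] using this
  have hsum := intervalIntegral.sum_integral_adjacent_intervals hint'
  simp only [Nat.cast_zero, zero_mul, Nat.cast_succ] at hsum
  rw [hKw] at hsum
  rw [integral_Icc_eq_integral_Ioc, ← intervalIntegral.integral_of_le hτ, ← hsum, ← Finset.sum_sub_distrib]
  have hterm : ∀ k ∈ Finset.range K,
      |(∫ s in ((k : ℝ) * w)..(((k : ℝ) + 1) * w), f s) - w * f ((k : ℝ) * w)| ≤ w * M k := by
    intro k hk
    have hk' := Finset.mem_range.1 hk
    have hc : (∫ _ in ((k : ℝ) * w)..(((k : ℝ) + 1) * w), f ((k : ℝ) * w)) = w * f ((k : ℝ) * w) := by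
      rw [intervalIntegral.integral_const, smul_eq_mul]
      ring
    rw [← hc, ← intervalIntegral.integral_sub (hint k hk') intervalIntegrable_const]
    have hb := intervalIntegral.norm_integral_le_of_norm_le_const (a := (k : ℝ) * w)
      (b := ((k : ℝ) + 1) * w) (C := M k) (f := fun s => f s - f ((k : ℝ) * w)) fun s hs => by
        rw [uIoc_of_le (hmono k)] at hs
        rw [Real.norm_eq_abs]
        exact hM k hk' s hs
    rw [Real.norm_eq_abs, show ((k : ℝ) + 1) * w - (k : ℝ) * w = w by ring, abs_of_pos hw] at hb
    linarith
  calc |∑ k ∈ Finset.range K, ((∫ s in ((k : ℝ) * w)..(((k : ℝ) + 1) * w), f s) - w * f ((k : ℝ) * w))|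
      ≤ ∑ k ∈ Finset.range K, |(∫ s in ((k : ℝ) * w)..(((k : ℝ) + 1) * w), f s) - w * f ((k : ℝ) * w)| :=
        Finset.abs_sum_le_sum_abs _ _
    _ ≤ ∑ k ∈ Finset.range K, w * M k := Finset.sum_le_sum hterm
    _ = w * ∑ k ∈ Finset.range K, M k := by rw [Finset.mul_sum]

/-! ## The pathwise window reduction -/

/-- **Pathwise window reduction of the Enskog time integral (constant mark).**  Along the orbit of a good
point `z` of a hard-sphere flow on `𝕋³` (reduced diameter `σ > 0`, `N + 1` spheres) with kinetic energy
`E(z) ≤ K (N+1)`, for continuous `χ, g`, `r, τ, a > 0`, constants `C_χ ≥ |χ|` on `[0, τ] × 𝕋³`, a time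
modulus `ω` of `χ` over the window length `w = windowLen N τ a`, `C_G ≥ |g·Y|` on `[0, ∞)`, and a modulus
`(κ, ϵ_G)` of `(g·Y)(b)·B` against factors `|B| ≤ (2πM√(2K)/σ³)·b`, `|B| ≤ 2πM²√(2K)` (as produced by
`exists_modulus_mul_le`) with `σ³ L √(2K) w ≤ κ` (`M = 3/(πr³)`, `L = 3/(πr⁴)`):
`|σ³ ∫_{[0,τ]} e_s(Φ_s z) ds − riemannEnskog σ N Φ τ a χ g r z|
   ≤ σ³ { τ (ω C_G · 2πM²√(2K) + C_χ ϵ_G + 8π C_χ C_G L M K w) + 4π C_χ C_G M² (w/(N+1)) · CPS((0, τ]) }`,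
`CPS` the collision pair sum of `1 + ‖vᵢ‖² + ‖vⱼ‖²` along the orbit. [cite: CIPDiluteGases1994, App. 4.A] -/
theorem abs_enskogIntegral_sub_riemannEnskog_le {σ : ℝ} {N : ℕ}
    (Φ : HardSphereFlow (Torus.geometry (Fin 3)) (hsDiameter σ N) (N + 1))
    {z : Config (N + 1) (Fin 3) T3} (hz : z ∈ Φ.good)
    {χ : ℝ × UnitAddTorus (Fin 3) → ℝ} {g : ℝ → ℝ} (hχ : Continuous χ) (hg : Continuous g)
    (hσ : 0 < σ) {r τ a : ℝ} (hr : 0 < r) (hτ : 0 < τ) (ha : 0 < a) {Cχ CG K ω κ ϵG : ℝ}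
    (hχb : ∀ s ∈ Icc (0 : ℝ) τ, ∀ y, |χ (s, y)| ≤ Cχ)
    (hχω : ∀ s ∈ Icc (0 : ℝ) τ, ∀ s' ∈ Icc (0 : ℝ) τ, |s - s'| ≤ windowLen N τ a →
      ∀ y, |χ (s, y) - χ (s', y)| ≤ ω)
    (hGb : ∀ b, 0 ≤ b → |g b * contactValue b| ≤ CG)
    (hK0 : 0 ≤ K) (hK : configEnergy z ≤ K * (N + 1 : ℕ))
    (hGmod : ∀ b b' B : ℝ, 0 ≤ b → 0 ≤ b' →
        |B| ≤ (2 * Real.pi * (3 / (Real.pi * r ^ 3)) * Real.sqrt (2 * K) / σ ^ 3) * b →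
        |B| ≤ 2 * Real.pi * (3 / (Real.pi * r ^ 3)) ^ 2 * Real.sqrt (2 * K) → |b - b'| ≤ κ →
        |g b * contactValue b - g b' * contactValue b'| * |B| ≤ ϵG)
    (hκ : σ ^ 3 * (3 / (Real.pi * r ^ 4)) * Real.sqrt (2 * K) * windowLen N τ a ≤ κ) :
    |σ ^ 3 * (∫ s in Icc (0 : ℝ) τ, enskogRate σ N χ g (fun _ => (1 : ℝ)) r s (Φ.flow s z)) -
        riemannEnskog σ N Φ τ a χ g r z| ≤
      σ ^ 3 * (τ * (ω * CG * (2 * Real.pi * (3 / (Real.pi * r ^ 3)) ^ 2 * Real.sqrt (2 * K)) + Cχ * ϵG +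
          8 * Real.pi * Cχ * CG * (3 / (Real.pi * r ^ 4)) * (3 / (Real.pi * r ^ 3)) * K * windowLen N τ a) +
        4 * Real.pi * Cχ * CG * (3 / (Real.pi * r ^ 3)) ^ 2 * (windowLen N τ a / (N + 1 : ℕ)) *
          collisionPairSum (Torus.geometry (Fin 3)) (hsDiameter σ N) (fun s => Φ.flow s z) (Ioc 0 τ)
            (fun t i j => 1 + ‖(Φ.flow t z i).2‖ ^ 2 + ‖(Φ.flow t z j).2‖ ^ 2)) := by
  -- notation and elementary facts
  set w := windowLen N τ a with hw_def
  set M := 3 / (Real.pi * r ^ 3) with hM_def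
  set L := 3 / (Real.pi * r ^ 4) with hL_def
  set V := Real.sqrt (2 * K) with hV_def
  set n : ℝ := ((N + 1 : ℕ) : ℝ) with hn_def
  set γ : ℝ → Config (N + 1) (Fin 3) T3 := fun s => Φ.flow s z with hγ_def
  set CPS : Set ℝ → ℝ := fun S => collisionPairSum (Torus.geometry (Fin 3)) (hsDiameter σ N) γ S
    (fun t i j => 1 + ‖(γ t i).2‖ ^ 2 + ‖(γ t j).2‖ ^ 2) with hCPS_def
  set f : ℝ → ℝ := fun s => enskogRate σ N χ g (fun _ => (1 : ℝ)) r s (γ s) with hf_def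
  have hγ : IsHardSphereTrajectory (Torus.geometry (Fin 3)) (hsDiameter σ N) (N + 1) γ :=
    Φ.isTrajectory z hz
  have hw : 0 < w := windowLen_pos N hτ ha
  have hKw : (windowNum N τ a : ℝ) * w = τ := windowNum_mul_windowLen N hτ ha
  have hn : 0 < n := by rw [hn_def]; exact_mod_cast Nat.succ_pos N
  have hM0 : 0 < M := by rw [hM_def]; positivity
  have hL0 : 0 < L := by rw [hL_def]; positivity
  have hV0 : 0 ≤ V := Real.sqrt_nonneg _
  have hVV : V * V = 2 * K := Real.mul_self_sqrt (by positivity)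
  have hCχ0 : 0 ≤ Cχ := (abs_nonneg _).trans (hχb 0 ⟨le_rfl, hτ.le⟩ 0)
  have hCG0 : 0 ≤ CG := (abs_nonneg _).trans (hGb 0 le_rfl)
  have hw0 : ∀ s, 0 ≤ CPS s := fun s => collisionPairSum_nonneg fun t i j => by positivity
  -- energy and speeds along the orbit
  have hE : ∀ s, configEnergy (γ s) ≤ K * n := fun s => by
    rw [show γ s = Φ.flow s z from rfl, Φ.configEnergy_flow hz s]; exact hK
  have hsqE : ∀ s, Real.sqrt (2 * configEnergy (γ s)) ≤ Real.sqrt n * V := fun s => by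
    rw [hV_def, ← Real.sqrt_mul hn.le]
    exact Real.sqrt_le_sqrt (by nlinarith [hE s])
  have hspeed : ∀ s, ∑ i, ‖(γ s i).2‖ ≤ n * V := fun s => by
    have h := sum_mul_norm_vel_le_sqrt (fun _ => (1 : ℝ)) (γ s)
    simp only [one_mul, one_pow, Finset.sum_const, Finset.card_univ, Fintype.card_fin, nsmul_eq_mul,
      mul_one] at h
    calc ∑ i, ‖(γ s i).2‖ ≤ Real.sqrt n * Real.sqrt (2 * configEnergy (γ s)) := h
      _ ≤ Real.sqrt n * (Real.sqrt n * V) := mul_le_mul_of_nonneg_left (hsqE s) (Real.sqrt_nonneg _)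
      _ = n * V := by rw [← mul_assoc, Real.mul_self_sqrt hn.le]
  -- the per-window oscillation bound
  have hwin : ∀ k < windowNum N τ a, ∀ s ∈ Ioc ((k : ℝ) * w) (((k : ℝ) + 1) * w),
      |f s - f ((k : ℝ) * w)| ≤
        (ω * CG * (2 * Real.pi * M ^ 2 * V) + Cχ * ϵG + 8 * Real.pi * Cχ * CG * L * M * K * w) +
          4 * Real.pi * Cχ * CG * M ^ 2 * (CPS (Ioc ((k : ℝ) * w) (((k : ℝ) + 1) * w)) / n) := by
    intro k hk s hs
    set s₀ : ℝ := (k : ℝ) * w with hs₀_def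
    have hk1 : (k : ℝ) + 1 ≤ windowNum N τ a := by exact_mod_cast hk
    have hs₀0 : 0 ≤ s₀ := by positivity
    have hs1 : s ≤ τ := hs.2.trans (by rw [← hKw]; exact mul_le_mul_of_nonneg_right hk1 hw.le)
    have hs₀s : s₀ ≤ s := hs.1.le
    have hsI : s ∈ Icc (0 : ℝ) τ := ⟨hs₀0.trans hs₀s, hs1⟩
    have hs₀I : s₀ ∈ Icc (0 : ℝ) τ := ⟨hs₀0, hs₀s.trans hs1⟩
    have hds : s - s₀ ≤ w := by have := hs.2; rw [hs₀_def]; linarith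
    have hds0 : 0 ≤ s - s₀ := sub_nonneg.2 hs₀s
    -- displacements
    have hd1 : ∑ i, Torus.euclidDist ((γ s i).1) ((γ s₀ i).1) ≤ n * V * w := by
      calc ∑ i, Torus.euclidDist ((γ s i).1) ((γ s₀ i).1)
          ≤ Real.sqrt ((N + 1 : ℕ) : ℝ) * Real.sqrt (2 * configEnergy (γ s₀)) * (s - s₀) :=
            hγ.sum_euclidDist_le_of_le hs₀s
        _ ≤ Real.sqrt n * (Real.sqrt n * V) * w :=
            mul_le_mul (mul_le_mul_of_nonneg_left (hsqE s₀) (Real.sqrt_nonneg _)) hds hds0 (by positivity)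
        _ = n * V * w := by rw [← mul_assoc, Real.mul_self_sqrt hn.le]
    have hd2 : ∑ i, Torus.euclidDist ((γ s i).1) ((γ s₀ i).1) * ‖(γ s i).2‖ ≤ 2 * (K * n) * w := by
      calc ∑ i, Torus.euclidDist ((γ s i).1) ((γ s₀ i).1) * ‖(γ s i).2‖
          = ∑ i, ‖(γ s i).2‖ * Torus.euclidDist ((γ s i).1) ((γ s₀ i).1) :=
            Finset.sum_congr rfl fun i _ => mul_comm _ _
        _ ≤ 2 * configEnergy (γ s₀) * (s - s₀) := hγ.sum_norm_vel_mul_euclidDist_le_of_le hs₀s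
        _ ≤ 2 * (K * n) * w := mul_le_mul (by nlinarith [hE s₀]) hds hds0 (by positivity)
    -- velocity variation inside the window
    have hv : ∑ i, ‖(γ s i).2 - (γ s₀ i).2‖ ≤ 2 * CPS (Ioc s₀ (((k : ℝ) + 1) * w)) := by
      refine (hγ.sum_norm_vel_sub_vel_le_torus hs₀s).trans ?_
      refine mul_le_mul_of_nonneg_left (collisionPairSum_mono_set (hγ.finite_collisionTimes_inter_Ioc _ _)
        (Ioc_subset_Ioc_right hs.2) fun t i j => by positivity) zero_le_two
    -- the mollified density and the pair functional along the window
    have hρ : ∀ y, |mollDensity r (γ s) y - mollDensity r (γ s₀) y| ≤ L * V * w := fun y => by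
      calc |mollDensity r (γ s) y - mollDensity r (γ s₀) y|
          ≤ L * (n⁻¹ * ∑ i, Torus.euclidDist ((γ s i).1) ((γ s₀ i).1)) :=
            abs_mollDensity_sub_mollDensity_le hr _ _ y
        _ ≤ L * (n⁻¹ * (n * V * w)) := by gcongr
        _ = L * V * w := by field_simp
    have hBρ : ∀ y, |pairFunctional r (fun _ => (1 : ℝ)) (γ s) y| ≤
        2 * Real.pi * M * V * mollDensity r (γ s) y := fun y => by
      calc |pairFunctional r (fun _ => (1 : ℝ)) (γ s) y|
          ≤ 2 * Real.pi * M * (n⁻¹ * ∑ i, ‖(γ s i).2‖) * mollDensity r (γ s) y :=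
            abs_pairFunctional_one_le hr _ y
        _ ≤ 2 * Real.pi * M * (n⁻¹ * (n * V)) * mollDensity r (γ s) y := by
            gcongr
            · exact mollDensity_nonneg_of_pos hr _ _
            · exact hspeed s
        _ = 2 * Real.pi * M * V * mollDensity r (γ s) y := by field_simp
    have hBM : ∀ y, |pairFunctional r (fun _ => (1 : ℝ)) (γ s) y| ≤ 2 * Real.pi * M ^ 2 * V := fun y => by
      calc |pairFunctional r (fun _ => (1 : ℝ)) (γ s) y| ≤ 2 * Real.pi * M * V * mollDensity r (γ s) y := hBρ y
        _ ≤ 2 * Real.pi * M * V * M := by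
            gcongr
            exact mollDensity_le hr _ _
        _ = 2 * Real.pi * M ^ 2 * V := by ring
    have hq₁ : ∀ y, |g (σ ^ 3 * mollDensity r (γ s) y) * contactValue (σ ^ 3 * mollDensity r (γ s) y) -
        g (σ ^ 3 * mollDensity r (γ s₀) y) * contactValue (σ ^ 3 * mollDensity r (γ s₀) y)| *
        |pairFunctional r (fun _ => (1 : ℝ)) (γ s) y| ≤ ϵG := by
      intro y
      have hσ3 : 0 < σ ^ 3 := pow_pos hσ 3
      refine hGmod _ _ _ (mul_nonneg hσ3.le (mollDensity_nonneg_of_pos hr _ _))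
        (mul_nonneg hσ3.le (mollDensity_nonneg_of_pos hr _ _)) ?_ ?_ ?_
      · rw [show 2 * Real.pi * (3 / (Real.pi * r ^ 3)) * Real.sqrt (2 * K) / σ ^ 3 *
            (σ ^ 3 * mollDensity r (γ s) y) = 2 * Real.pi * M * V * mollDensity r (γ s) y by
          rw [hM_def, hV_def]; field_simp]
        exact hBρ y
      · exact hBM y
      · rw [← mul_sub, abs_mul, abs_of_pos hσ3]
        calc σ ^ 3 * |mollDensity r (γ s) y - mollDensity r (γ s₀) y| ≤ σ ^ 3 * (L * V * w) :=
              mul_le_mul_of_nonneg_left (hρ y) hσ3.le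
          _ = σ ^ 3 * (3 / (Real.pi * r ^ 4)) * Real.sqrt (2 * K) * windowLen N τ a := by
              rw [hL_def, hV_def, hw_def]; ring
          _ ≤ κ := hκ
    have hq₂ : ∀ y, |pairFunctional r (fun _ => (1 : ℝ)) (γ s) y - pairFunctional r (fun _ => (1 : ℝ)) (γ s₀) y|
        ≤ Real.pi * (8 * L * M * K * w + 4 * M ^ 2 * CPS (Ioc s₀ (((k : ℝ) + 1) * w)) / n) := by
      intro y
      have h23 : (∑ i, Torus.euclidDist ((γ s i).1) ((γ s₀ i).1)) * ∑ j, ‖(γ s j).2‖ ≤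
          n * n * (2 * K) * w := by
        calc (∑ i, Torus.euclidDist ((γ s i).1) ((γ s₀ i).1)) * ∑ j, ‖(γ s j).2‖
            ≤ (n * V * w) * (n * V) := mul_le_mul (hd1) (hspeed s)
              (Finset.sum_nonneg fun j _ => norm_nonneg _) (by positivity)
          _ = n * n * (V * V) * w := by ring
          _ = n * n * (2 * K) * w := by rw [hVV]
      calc |pairFunctional r (fun _ => (1 : ℝ)) (γ s) y - pairFunctional r (fun _ => (1 : ℝ)) (γ s₀) y|
          ≤ Real.pi * (n⁻¹ * n⁻¹) * (L * M *
              (2 * (N + 1 : ℕ) * ∑ i, Torus.euclidDist ((γ s i).1) ((γ s₀ i).1) * ‖(γ s i).2‖ +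
                2 * ((∑ i, Torus.euclidDist ((γ s i).1) ((γ s₀ i).1)) * ∑ j, ‖(γ s j).2‖)) +
              M ^ 2 * (2 * (N + 1 : ℕ) * ∑ i, ‖(γ s i).2 - (γ s₀ i).2‖)) :=
            abs_pairFunctional_one_sub_le hr _ _ y
        _ ≤ Real.pi * (n⁻¹ * n⁻¹) * (L * M * (2 * n * (2 * (K * n) * w) + 2 * (n * n * (2 * K) * w)) +
              M ^ 2 * (2 * n * (2 * CPS (Ioc s₀ (((k : ℝ) + 1) * w))))) := by
            rw [← hn_def]
            gcongr
        _ = Real.pi * (8 * L * M * K * w + 4 * M ^ 2 * CPS (Ioc s₀ (((k : ℝ) + 1) * w)) / n) := by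
            field_simp
            ring
    -- the three-term splitting
    have hmain := abs_enskogRate_one_sub_le (t := s) (t' := s₀) (z := γ s) (z' := γ s₀) hχ hg hσ.le hr
      (hχb s₀ hs₀I) (fun y => hχω s hsI s₀ hs₀I (by rw [abs_of_nonneg hds0]; exact hds) y) hGb hBM hq₁ hq₂
    refine hmain.trans (le_of_eq ?_)
    rw [hs₀_def]
    ring
  -- integrability of the rate along the orbit and the Riemann estimate
  have hint : IntegrableOn f (Icc 0 τ) :=
    integrableOn_enskogRate_flow Φ hz hχ hg hχb hGb hσ.le hr measurable_sphereMark_one abs_sphereMark_one_le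
  have hR := abs_setIntegral_Icc_sub_riemann_le hw hKw hint hwin
  have hsumCPS : ∑ k ∈ Finset.range (windowNum N τ a), CPS (Ioc ((k : ℝ) * w) (((k : ℝ) + 1) * w)) =
      CPS (Ioc 0 τ) := by
    rw [hCPS_def]
    simp only []
    rw [hγ.sum_collisionPairSum_Ioc_eq _ hw.le, hKw]
  -- assemble
  have hRE : riemannEnskog σ N Φ τ a χ g r z =
      σ ^ 3 * ∑ k ∈ Finset.range (windowNum N τ a), w * f ((k : ℝ) * w) := rfl
  rw [hRE, ← mul_sub, abs_mul, abs_of_nonneg (pow_nonneg hσ.le 3)]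
  refine mul_le_mul_of_nonneg_left (hR.trans (le_of_eq ?_)) (pow_nonneg hσ.le 3)
  rw [Finset.sum_add_distrib, Finset.sum_const, Finset.card_range, nsmul_eq_mul, ← Finset.mul_sum,
    ← Finset.sum_div, hsumCPS, mul_add, ← mul_assoc, mul_comm w (windowNum N τ a : ℝ), hKw]
  rw [hM_def, hL_def, hV_def, hn_def]
  ring

end Literature.MathematicalPhysics.KineticTheory

end
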